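import Mathlib
import Summits.RiemannHypothesis.RiemannHypothesis.Theorems.WeilFormatCJointShiftSOS
import Summits.RiemannHypothesis.RiemannHypothesis.Theorems.WeilFormatCCellShiftCert
import Summits.RiemannHypothesis.RiemannHypothesis.Theorems.WeilFormatCCellShiftCertSound
import Summits.RiemannHypothesis.RiemannHypothesis.Theorems.WeilFormatCCellShiftCertRange
import Summits.RiemannHypothesis.RiemannHypothesis.Theorems.WeilFormatCCellShiftCertA1p4
import Summits.RiemannHypothesis.RiemannHypothesis.Theorems.WeilFormatCCellShiftCertA1p4T
import Summits.RiemannHypothesis.RiemannHypothesis.Theorems.WeilFormatCCellShiftCertA1p4Parts0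
import Summits.RiemannHypothesis.RiemannHypothesis.Theorems.WeilFormatCCellShiftCertA1p4Parts1
import Summits.RiemannHypothesis.RiemannHypothesis.Theorems.WeilFormatCCellShiftCertA1p4Parts2
import Summits.RiemannHypothesis.RiemannHypothesis.Theorems.WeilFormatCPrimeFormJointOf
import HarnessLib

/-!
# The JOINT prime-shift bound on windows `[−a, a]`, `a ≤ 1`, from a CELL-REFINED certificate (v2: 4 cells, row-range kernel parts): constant `2027/1000`

Helper file (`--supports stmt-RiemannHypothesis-0098`, lead-track anchor: Weil-positivity window ladder, format C far bound), RH-free.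
Seat rh-explicit-weil-1 gen3, route K3 (memo `run/shared/lean/pub/rh-explicit/rh-explicit-weil-1/WEIL1-SIZELAW.md` §7).  For every real
measurable bounded `f` vanishing off `[−a, a]` with `0 ≤ a ≤ 1` (window prime powers `2, 3, 4, 5, 7`):

* `WeilFormatC.jointShiftBound_one_cells_v2` —
  **`Σ_{n = 2,3,4,5,7} 2·(Λ(n)/√n) · ∫_{[−a,a]} f(x − log n) f(x) dx ≤ (2027/1000) · ∫_{[−a,a]} f²`**,

and the format-C consequence `WeilFormatC.primeCoeff_form_ge_cells_one_v2`: **`−(2027/1000)·Σ_{n∈s}|c_n|² ≤ Σ_{n,m∈s} Re(conj c_n c_m)·primeCoeff a n m`**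
for every `0 < a ≤ 1` (hypothesis `hP` of `WeilFormatC.farBlock_ge_dhat` with `A := 2027/1000`; previous kernel constants on this
range: `2386/1000` (K2, `JointSOS.certA1`, p325302) / `2387/1000` (cell file p325644); true compression norm ≈ 1.944).  Ingredients: the
cell checker and its soundness `WeilFormatCCellShiftCert{,Cells,Corr,Table,Sound}.lean`, the certificate `CellSOS.cellA1p4`
(`WeilFormatCCellShiftCertA1p4.lean`, 4 cells, exact constant `CellSOS.cellA1p4.D`), and `primeCoeff_form_ge_of_jointShiftBound`.  Standard axioms only.
-/

set_option linter.dupNamespace false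

noncomputable section

open MeasureTheory Set Complex Finset
open scoped Real ComplexConjugate BigOperators

namespace Summit.RiemannHypothesis.RiemannHypothesis.Theorems.WeilFormatC

open CellSOS Literature.NumberTheory.LFunctions Literature.NumberTheory.LFunctions.Yoshida1992

/-- **Joint prime-shift bound at `a ≤ 1` (whole-line integrals), cell-refined certificate `cellA1p4`.**  For `f` real
measurable bounded vanishing off `[−a, a]`: `Σ_{n=2,3,4,5,7} 2(Λ(n)/√n) ∫ f(x − log n) f(x) dx ≤ cellA1p4.D · ∫ f²`. [folklore] -/
theorem jointShiftBound_one_cells_v2_real {a : ℝ} (ha : a ≤ 1) {f : ℝ → ℝ} (hf : Measurable f) {C : ℝ}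
    (hC : ∀ x, |f x| ≤ C) (hsupp : ∀ x, x ∉ Icc (-a) a → f x = 0) :
    2 * (Real.log 2 / Real.sqrt 2) * (∫ x, f (x - Real.log 2) * f x) +
      2 * (Real.log 3 / Real.sqrt 3) * (∫ x, f (x - Real.log 3) * f x) +
      2 * (Real.log 2 / 2) * (∫ x, f (x - 2 * Real.log 2) * f x) +
      2 * (Real.log 5 / Real.sqrt 5) * (∫ x, f (x - Real.log 5) * f x) +
      2 * (Real.log 7 / Real.sqrt 7) * (∫ x, f (x - Real.log 7) * f x)
      ≤ (cellA1p4.D : ℝ) * ∫ x, f x ^ 2 := by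
  have ha' : a ≤ (cellA1p4.aQ : ℝ) := by
    rw [show cellA1p4.aQ = 1 from rfl]; push_cast; linarith
  have hparts : ∀ k < cellA1p4.nparts, cellA1p4.checkTab cellA1p4T k = true := by
    intro k hk
    have hk' : k < 6 := hk
    interval_cases k
    · exact cellA1p4_tabR0
    · exact cellA1p4_tabR1
    · exact cellA1p4_tabR2
    · exact cellA1p4_tabR3
    · exact cellA1p4_tabR4
    · exact cellA1p4_tabR5
  have h := CellSOS.Cert.sound_real_M cellA1p4 cellA1p4T cellA1p4_check hparts cellA1p4_merge ha' hf hC hsupp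
  have hw : cellA1p4.toJ.witems = [(0, 1, 1630477228166597776), (1, 1, 1996918623117814387), (0, 2, 2305843009213693952), (2, 1, 2578010857022246786), (3, 1, 3050343582368125807)] := rfl
  have p0 : cellA1p4.toJ.pj 0 = 2 := rfl
  have p1 : cellA1p4.toJ.pj 1 = 3 := rfl
  have p2 : cellA1p4.toJ.pj 2 = 5 := rfl
  have p3 : cellA1p4.toJ.pj 3 = 7 := rfl
  rw [hw] at h
  have h4 : Real.sqrt ((2 : ℝ) ^ 2) = 2 := Real.sqrt_sq (by norm_num)
  simp only [List.map_cons, List.map_nil, List.sum_cons, List.sum_nil, p0, p1, p2, p3, Nat.cast_ofNat,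
    Nat.cast_one, one_mul, pow_one, add_zero, h4] at h
  linarith

/-- **Joint prime-shift bound at `0 ≤ a ≤ 1` (window integrals, constant `2027/1000`).** [folklore] -/
theorem jointShiftBound_one_cells_v2 {a : ℝ} (ha0 : 0 ≤ a) (ha : a ≤ 1) {f : ℝ → ℝ} (hf : Measurable f) {C : ℝ}
    (hC : ∀ x, |f x| ≤ C) (hsupp : ∀ x, x ∉ Icc (-a) a → f x = 0) :
    2 * (Real.log 2 / Real.sqrt 2) * (∫ x in (-a)..a, f (x - Real.log 2) * f x) +
      2 * (Real.log 3 / Real.sqrt 3) * (∫ x in (-a)..a, f (x - Real.log 3) * f x) +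
      2 * (Real.log 2 / 2) * (∫ x in (-a)..a, f (x - 2 * Real.log 2) * f x) +
      2 * (Real.log 5 / Real.sqrt 5) * (∫ x in (-a)..a, f (x - Real.log 5) * f x) +
      2 * (Real.log 7 / Real.sqrt 7) * (∫ x in (-a)..a, f (x - Real.log 7) * f x)
      ≤ (2027 / 1000 : ℝ) * ∫ x in (-a)..a, f x ^ 2 := by
  have hle : -a ≤ a := by linarith
  have h := jointShiftBound_one_cells_v2_real ha hf hC hsupp
  rw [shiftCorr_eq_intervalIntegral hsupp hle, shiftCorr_eq_intervalIntegral hsupp hle,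
    shiftCorr_eq_intervalIntegral hsupp hle, shiftCorr_eq_intervalIntegral hsupp hle,
    shiftCorr_eq_intervalIntegral hsupp hle, integral_sq_eq_intervalIntegral hsupp hle] at h
  have hD : (cellA1p4.D : ℝ) ≤ 2027 / 1000 := by
    have hq : cellA1p4.D ≤ 2027 / 1000 := by
      show ((2026813114838123 : ℚ) / 1000000000000000 : ℚ) ≤ 2027 / 1000
      norm_num
    calc (cellA1p4.D : ℝ) ≤ ((2027 / 1000 : ℚ) : ℝ) := Rat.cast_le.2 hq
      _ = 2027 / 1000 := by norm_num
  have hE : 0 ≤ ∫ x in (-a)..a, f x ^ 2 :=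
    intervalIntegral.integral_nonneg hle fun x _ ↦ sq_nonneg _
  nlinarith [mul_le_mul_of_nonneg_right hD hE]

/-- **PRIME ⪰ −(2027/1000)·1 on every finite set of modes, for every window `0 < a ≤ 1`** (hypothesis `hP` of
`WeilFormatC.farBlock_ge_dhat` with `A := 2027/1000`; cell-refined certificate `cellA1p4`). [folklore] -/
theorem primeCoeff_form_ge_cells_one_v2 {a : ℝ} (ha : 0 < a) (ha' : a ≤ 1) (s : Finset ℤ) (c : ℤ → ℂ) :
    -((2027 / 1000 : ℝ) * ∑ n ∈ s, ‖c n‖ ^ 2)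
      ≤ ∑ n ∈ s, ∑ m ∈ s, (conj (c n) * c m).re * primeCoeff a n m := by
  have hD : (cellA1p4.D : ℝ) ≤ 2027 / 1000 := by
    have hq : cellA1p4.D ≤ 2027 / 1000 := by
      show ((2026813114838123 : ℚ) / 1000000000000000 : ℚ) ≤ 2027 / 1000
      norm_num
    calc (cellA1p4.D : ℝ) ≤ ((2027 / 1000 : ℚ) : ℝ) := Rat.cast_le.2 hq
      _ = 2027 / 1000 := by norm_num
  refine primeCoeff_form_ge_of_jointShiftBound ha (by linarith) (A := 2027 / 1000) (fun u C hu hCu hsu ↦ ?_) s c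
  have h := jointShiftBound_one_cells_v2_real ha' hu hCu hsu
  have hE : 0 ≤ ∫ x, u x ^ 2 := integral_nonneg fun x ↦ sq_nonneg _
  nlinarith [mul_le_mul_of_nonneg_right hD hE]

end Summit.RiemannHypothesis.RiemannHypothesis.Theorems.WeilFormatC
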